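import Mathlib
import Summits.NavierStokesRegularity.NavierStokesRegularity.Theorems.EulerZoomLiouvillePowerGaugeEulerLiouvilleCondenserCrossings

/-!
# THEOREM B in gauge form: leaving `B(0,2R)` backward costs a gradient `(γ/2)·exp(c·R^{2+ρ})` (t44-B, nsreg-p2 g33 plate; ROUND-42 §1)

The class-gauge reading of ns-ezl-w2 g3's `Condenser.exp_le_gradient_or_small_of_exit` (THEOREM B, dynamic form): with the
A-gauge and E-gauge ball budgets `∫_{B(0,3R)}‖V‖² ≤ C_A(3R)^{1−2ρ}`, `∫_{B(0,3R)}‖DV‖² ≤ C_E(3R)^{1−ρ}` (`0 ≤ ρ`) there is a scale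
`R₁ = R₁(γ, ρ, C_A, C_E)` such that for every `R ≥ R₁`, every `C¹` field `V` with globally bounded derivative obeying the two
budgets, and every label `y`, `‖y‖ < R`, whose backward similarity orbit `Ψ' = −(γΨ + V(Ψ))` reaches `‖Ψ_L y‖ ≥ 2R`:

  `∃ z ∈ B(0,3R), ‖DV(z)‖ ≥ (γ/2)·exp( (πγ²/(128·3^{1−ρ}·C_E)) · R^{2+ρ} )`.

* `condenserExponent_eq` — `π(γR)²/(32·(4Y/R)) = (πγ²/(128·3^{1−ρ}C_E))·R^{2+ρ}` for `Y = C_E(3R)^{1−ρ}` (the clock exponent `2+ρ`);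
* `condenserRoom_of_le` — the room inequality of the plane condenser at scales `R ≥ max 1 (2048·C_A·3^{1−2ρ}/(3πγ²))`;
* `log_two_lt_mul_rpow` — the exponent beats `log 2` at scales `R ≥ max 1 (log 2/c + 1)`;
* **`exists_gradient_ge_exp_rpow_of_exit` — THEOREM B in gauge form** (= ROUND-42 `TheoremB` with `z ∈ B(0,3R)` and without the
  immaterial polynomial prefactor; contrapositive packaging of the sup bound `G_m`).

WHAT THIS IS NOT: not NS, not E = 19832 (OPEN) — Theorem B PRICES the enemy (α) of THE ONE STATEMENT, it does not kill it; a `C²`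
profile may have such gradients.  [folklore; setting: ConstantinIgnatovaVicol2026Putative §3.4.1]
-/

noncomputable section

open Set Metric MeasureTheory Real
open scoped RealInnerProductSpace

set_option linter.dupNamespace false

namespace Summit.NavierStokesRegularity.NavierStokesRegularity.Theorems.PowerGaugeEulerLiouville.Condenser

open Literature.Analysis Literature.Analysis.FluidPDE

/-- **The condenser exponent in gauge form.**  With the E-gauge slice budget `Y = C_E (3R)^{1−ρ}`:
`π(γR)²/(32·(4Y/R)) = (πγ²/(128·3^{1−ρ}·C_E))·R^{2+ρ}` — the clock exponent `2+ρ`. [folklore] -/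
theorem condenserExponent_eq {γ ρ C_E R : ℝ} (hCE : 0 < C_E) (hR : 0 < R) :
    Real.pi * (γ * R) ^ 2 / (32 * (4 * (C_E * (3 * R) ^ (1 - ρ)) / R)) =
      Real.pi * γ ^ 2 / (128 * (3 : ℝ) ^ (1 - ρ) * C_E) * R ^ (2 + ρ) := by
  have h3R : (3 * R) ^ (1 - ρ) = (3 : ℝ) ^ (1 - ρ) * R ^ (1 - ρ) := Real.mul_rpow (by norm_num) hR.le
  have hR3 : R ^ (2 + ρ) = R ^ 3 * (R ^ (1 - ρ))⁻¹ := by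
    rw [show (2 + ρ : ℝ) = 3 + -(1 - ρ) by ring, Real.rpow_add hR, Real.rpow_neg hR.le]
    congr 1
    exact_mod_cast Real.rpow_natCast R 3
  have hpos1 : 0 < R ^ (1 - ρ) := Real.rpow_pos_of_pos hR _
  have hpos3 : 0 < (3 : ℝ) ^ (1 - ρ) := Real.rpow_pos_of_pos (by norm_num) _
  rw [h3R, hR3]
  field_simp
  ring

/-- **Room at large scales.**  With `X = C_A(3R)^{1−2ρ}`, `0 ≤ ρ` and `R ≥ max 1 (2048·C_A·3^{1−2ρ}/(3πγ²))`, the room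
inequality `8(4X/R)/(π(γR)²) ≤ (3/4)(R/4)²` of the plane condenser holds. [folklore] -/
theorem condenserRoom_of_le {γ ρ C_A R : ℝ} (hγ : 0 < γ) (hρ : 0 ≤ ρ) (hCA : 0 < C_A) (h1 : 1 ≤ R)
    (hK : 2048 * C_A * (3 : ℝ) ^ (1 - 2 * ρ) / (3 * Real.pi * γ ^ 2) ≤ R) :
    8 * (4 * (C_A * (3 * R) ^ (1 - 2 * ρ)) / R) / (Real.pi * (γ * R) ^ 2) ≤ 3 / 4 * (R / 4) ^ 2 := by
  have hR : 0 < R := by linarith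
  have hπ : 0 < Real.pi := Real.pi_pos
  have hpos3 : 0 < (3 : ℝ) ^ (1 - 2 * ρ) := Real.rpow_pos_of_pos (by norm_num) _
  have h3R : (3 * R) ^ (1 - 2 * ρ) = (3 : ℝ) ^ (1 - 2 * ρ) * R ^ (1 - 2 * ρ) := Real.mul_rpow (by norm_num) hR.le
  -- `R^{1−2ρ} ≤ R`
  have hRle : R ^ (1 - 2 * ρ) ≤ R := by
    calc R ^ (1 - 2 * ρ) ≤ R ^ (1 : ℝ) := Real.rpow_le_rpow_of_exponent_le h1 (by linarith)
      _ = R := Real.rpow_one R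
  have hX : C_A * (3 * R) ^ (1 - 2 * ρ) ≤ C_A * (3 : ℝ) ^ (1 - 2 * ρ) * R := by
    rw [h3R, ← mul_assoc]
    exact mul_le_mul_of_nonneg_left hRle (by positivity)
  -- `2048·C_A·3^{1−2ρ} ≤ 3πγ²·R ≤ 3πγ²·R⁴`
  have hK' : 2048 * C_A * (3 : ℝ) ^ (1 - 2 * ρ) ≤ 3 * Real.pi * γ ^ 2 * R := by
    have h := (div_le_iff₀ (by positivity : (0 : ℝ) < 3 * Real.pi * γ ^ 2)).1 hK
    linarith [h]
  have hR4 : R ≤ R ^ 4 := by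
    calc R = R ^ 1 := (pow_one R).symm
      _ ≤ R ^ 4 := pow_le_pow_right₀ h1 (by norm_num)
  have hK4 : 2048 * C_A * (3 : ℝ) ^ (1 - 2 * ρ) ≤ 3 * Real.pi * γ ^ 2 * R ^ 4 :=
    hK'.trans (mul_le_mul_of_nonneg_left hR4 (by positivity))
  have e1 : 8 * (4 * (C_A * (3 * R) ^ (1 - 2 * ρ)) / R) / (Real.pi * (γ * R) ^ 2) =
      32 * (C_A * (3 * R) ^ (1 - 2 * ρ)) / (Real.pi * γ ^ 2 * R ^ 3) := by
    field_simp
    ring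
  rw [e1, div_le_iff₀ (by positivity)]
  -- goal: `32 X ≤ 3/4 (R/4)² (π γ² R³)`
  have hXR : 32 * (C_A * (3 * R) ^ (1 - 2 * ρ)) ≤ 32 * (C_A * (3 : ℝ) ^ (1 - 2 * ρ) * R) := by linarith
  have hfin : 32 * (C_A * (3 : ℝ) ^ (1 - 2 * ρ) * R) ≤ 3 / 4 * (R / 4) ^ 2 * (Real.pi * γ ^ 2 * R ^ 3) := by
    have : 3 / 4 * (R / 4) ^ 2 * (Real.pi * γ ^ 2 * R ^ 3) = (3 * Real.pi * γ ^ 2 * R ^ 4) * R / 64 := by ring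
    rw [this]
    have h64 : 32 * (C_A * (3 : ℝ) ^ (1 - 2 * ρ) * R) = (2048 * C_A * (3 : ℝ) ^ (1 - 2 * ρ)) * R / 64 := by ring
    rw [h64]
    exact div_le_div_of_nonneg_right (mul_le_mul_of_nonneg_right hK4 hR.le) (by norm_num)
  exact hXR.trans hfin

/-- **The exponent beats `log 2` at large scales**: `0 < c`, `0 ≤ ρ`, `R ≥ max 1 (log 2/c + 1)` ⇒ `log 2 < c·R^{2+ρ}`. [folklore] -/
theorem log_two_lt_mul_rpow {c ρ R : ℝ} (hc : 0 < c) (hρ : 0 ≤ ρ) (h1 : 1 ≤ R) (hK : Real.log 2 / c + 1 ≤ R) :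
    Real.log 2 < c * R ^ (2 + ρ) := by
  have hRle : R ≤ R ^ (2 + ρ) := by
    calc R = R ^ (1 : ℝ) := (Real.rpow_one R).symm
      _ ≤ R ^ (2 + ρ) := Real.rpow_le_rpow_of_exponent_le h1 (by linarith)
  have h2 : Real.log 2 < c * R := by
    have h := (div_le_iff₀' hc).1 (show Real.log 2 / c ≤ R - 1 by linarith)
    nlinarith
  exact h2.trans_le (mul_le_mul_of_nonneg_left hRle hc.le)

/-- **THEOREM B IN GAUGE FORM (ROUND-42 §1).**  `0 < γ`, `0 ≤ ρ`, gauge constants `C_A, C_E > 0`: there is `R₁ > 0` such that for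
every `C¹` field `V` with globally bounded derivative, every `R ≥ R₁` at which the ball budgets
`∫_{B(0,3R)}‖V‖² ≤ C_A(3R)^{1−2ρ}`, `∫_{B(0,3R)}‖DV‖² ≤ C_E(3R)^{1−ρ}` hold, and every label `‖y‖ < R` whose backward similarity orbit
reaches `‖Ψ_L y‖ ≥ 2R` (`L ≥ 0`), some `z ∈ B(0,3R)` has `‖DV(z)‖ ≥ (γ/2)·exp((πγ²/(128·3^{1−ρ}C_E))·R^{2+ρ})`.
[ns-ezl-w2 g3 `exp_le_gradient_or_small_of_exit` + the three arithmetic lemmas above; folklore] -/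
theorem exists_gradient_ge_exp_rpow_of_exit {γ ρ C_A C_E : ℝ} (hγ : 0 < γ) (hρ : 0 ≤ ρ) (hCA : 0 < C_A) (hCE : 0 < C_E) :
    ∃ R₁ : ℝ, 0 < R₁ ∧
      ∀ (V : EuclideanSpace ℝ (Fin 3) → EuclideanSpace ℝ (Fin 3)) (K : ℝ),
        ContDiff ℝ 1 V → (∀ y, ‖fderiv ℝ V y‖ ≤ K) →
        ∀ R : ℝ, R₁ ≤ R →
          (∫ x in ball (0 : EuclideanSpace ℝ (Fin 3)) (3 * R), ‖V x‖ ^ 2 ≤ C_A * (3 * R) ^ (1 - 2 * ρ)) →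
          (∫ x in ball (0 : EuclideanSpace ℝ (Fin 3)) (3 * R), ‖fderiv ℝ V x‖ ^ 2 ≤ C_E * (3 * R) ^ (1 - ρ)) →
          ∀ (y : EuclideanSpace ℝ (Fin 3)) (L : ℝ), 0 ≤ L → ‖y‖ < R →
            2 * R ≤ ‖ODE.evolutionMap (fun _ : ℝ => selfSimilarTransport γ 0 V) 0 (-L) y‖ →
            ∃ z ∈ ball (0 : EuclideanSpace ℝ (Fin 3)) (3 * R),
              γ / 2 * Real.exp (Real.pi * γ ^ 2 / (128 * (3 : ℝ) ^ (1 - ρ) * C_E) * R ^ (2 + ρ)) ≤ ‖fderiv ℝ V z‖ := by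
  set c₂ : ℝ := Real.pi * γ ^ 2 / (128 * (3 : ℝ) ^ (1 - ρ) * C_E) with hc₂
  have h3 : 0 < (3 : ℝ) ^ (1 - ρ) := Real.rpow_pos_of_pos (by norm_num) _
  have hc₂pos : 0 < c₂ := by
    rw [hc₂]
    have : 0 < Real.pi := Real.pi_pos
    positivity
  set Ka : ℝ := 2048 * C_A * (3 : ℝ) ^ (1 - 2 * ρ) / (3 * Real.pi * γ ^ 2) with hKa_def
  set Kb : ℝ := Real.log 2 / c₂ + 1 with hKb_def
  refine ⟨max 1 (max Ka Kb), lt_max_of_lt_left one_pos, ?_⟩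
  intro V K hV hK R hR hA hE y L hL hy hexit
  have h1 : 1 ≤ R := (le_max_left _ _).trans hR
  have hKa : Ka ≤ R := ((le_max_left _ _).trans (le_max_right _ _)).trans hR
  have hKb : Kb ≤ R := ((le_max_right _ _).trans (le_max_right _ _)).trans hR
  have hR0 : 0 < R := by linarith
  have hX : 0 < C_A * (3 * R) ^ (1 - 2 * ρ) := mul_pos hCA (Real.rpow_pos_of_pos (by positivity) _)
  have hY : 0 < C_E * (3 * R) ^ (1 - ρ) := mul_pos hCE (Real.rpow_pos_of_pos (by positivity) _)
  have hroom := condenserRoom_of_le hγ hρ hCA h1 hKa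
  have hexp : Real.pi * (γ * R) ^ 2 / (32 * (4 * (C_E * (3 * R) ^ (1 - ρ)) / R)) = c₂ * R ^ (2 + ρ) :=
    condenserExponent_eq hCE hR0
  have hlog : Real.log 2 < c₂ * R ^ (2 + ρ) := log_two_lt_mul_rpow hc₂pos hρ h1 hKb
  by_contra hcon
  push Not at hcon
  have hGm : ∀ z ∈ ball (0 : EuclideanSpace ℝ (Fin 3)) (3 * R), ‖fderiv ℝ V z‖ ≤ γ / 2 * Real.exp (c₂ * R ^ (2 + ρ)) :=
    fun z hz => (hcon z hz).le
  have h := exp_le_gradient_or_small_of_exit hV hK hγ hR0 hX hY hA hE hGm hy hL hexit hroom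
  rw [hexp] at h
  rcases h with h | h
  · have e1 : γ * R / (4 * (R / 4)) = γ := by field_simp
    rw [e1] at h
    have hexp0 : 0 < Real.exp (c₂ * R ^ (2 + ρ)) := Real.exp_pos _
    have hs : Real.sqrt 2 < 2 := (Real.sqrt_lt' (by norm_num)).2 (by norm_num)
    nlinarith [mul_pos (sub_pos.2 hs) (mul_pos hγ hexp0)]
  · exact absurd h (not_le.2 hlog)

end Summit.NavierStokesRegularity.NavierStokesRegularity.Theorems.PowerGaugeEulerLiouville.Condenser

end
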